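import Summits.QuantumFields.BalabanUV.Beta.EriceRemainderEnclosureHistoryAutonomyComparisonAgeCompositionOldBlockSeparatedAges
import Summits.QuantumFields.BalabanUV.Beta.EriceRemainderEnclosureHistoryAutonomyComparisonAgeCompositionOldBlockCapWide
import Summits.QuantumFields.BalabanUV.Beta.EriceRemainderEnclosureHistoryAutonomyComparisonAgeCompositionOldBlockYoungestGap

/-!
# EriceRemainderEnclosureHistoryAutonomyComparisonAgeCompositionOldBlockSeparatedAgesWide — (E100f) route (N), first order: DOUBLE OCTAVES AS CASCADE
# LEVELS.  (E100e) `old_block_load_le_span4` caps ANY finite set of ages inside `[a, 4a]` (`56 ≤ a`) at `11∕16`; (E100c) `flow_nonneg_old_block_levels_of_cap`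
# takes the block cap as a hypothesis.  Closure with `s = 11∕16` at `κ = 1∕5`: `0.2 + 4·(11∕16)·1.2 = 3.5 ≤ R₀·(1 − 0.825)·0.2 = 0.035·R₀` iff `R₀ ≥ 100`:
# **`flow_nonneg_census_young_pair_double_octaves`** (the census young pair `{1, k₂}`, `2 ≤ k₂ ≤ 29`, below a ×100 chain of double octaves
# `T_j ⊂ [a_j, p_j]`, `p_j ≤ 4a_j`, `100k₂ ≤ a_1`, `100p_j ≤ a_{j+1}`), **`flow_nonneg_young_age_double_octaves`** (any young age, the same chain),
# **`flow_nonneg_young_age_gap_double_octaves`** (any young age at ratio `49` below the chain, (E100d)'s sharp-youngest-gap form: `8.53944 ≤ 8.575`); and with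
# ONE double octave on top only the last-step closure of (E99g) (`ρ₀ ≥ 4s·s₀∕((1−s)(1−s₀))` = `44` ∕ `21.3`): **`flow_nonneg_census_young_pair_one_double_octave`**
# (gap `45k₂ ≤ a`; `κ = 1∕1000`, `ρ₀ = 45`: `13.9872 ≤ 14.0316`), **`flow_nonneg_young_age_one_double_octave`** (gap `22a₀ ≤ a`, `56 ≤ a`; `ρ₀ = 22`:
# `6.7988 ≤ 6.8599`).  So the census four ages `{1, k₂, k₃, k₄}` hold for `2 ≤ k₂ ≤ 29`, `45k₂ ≤ k₃`, `k₃ < k₄ ≤ 4k₃` (top ratio up to 4; (E99g) had 2).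

Cell `pub-balaban`, β-function sub-cell, BINDER row D4 «RemainderConst leaves for Bałaban's split» (`HOME/BINDER-OWNERS.md`; owner lineage `b2b-balaban-beta-an4`;
this file by co-owner #2 lineage `b2b-balaban-beta-d4-p2`, generation 88), β-FLOW TEAM duty (1), FREEZE (0) honoured (def-free; nothing restated).

HONEST FRAMING (page 1, verbatim and binding).  *"Discharging BetaPertH makes Bałaban's UV stability UNCONDITIONAL — a real constructive-QFT result; it is
NOT the continuum limit and NOT the Clay problem."*  THIS FILE DISCHARGES NOTHING OF THE KIND.  Elementary real algebra ∕ real analysis about ABSTRACT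
functionals on a box ]0,γ]^ℕ with displayed floors, profiles and signs, and the FIRST-ORDER renewal objects of route (N) built from them — hypotheses of a
census, not facts; the form, signs, ages and moments of Bałaban's (1.22) limit functional are NOT PRINTED ([I] p. 298; GAPS G-t4-U2-1∕-2) and NOT asserted.
Row D4 class UNCHANGED (critical-path width 0; instance 0∕1; D4 DISCHARGE NO DATE).  HONEST DEPENDENCY: continuum YM on T⁴ ⇐ BetaPertH ∧ nine spine
estimates (0/9 proved); BetaPertH ⇐ (D1) ∧ (D4) ∧ CAP+tail; G-an2-4 gates asym, D1 and NE2/3/4.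

THE POINT (README `HOME/b2b-balaban-beta-d4-p2/g88/README.md` §4).  Uses (E100c) `flow_nonneg_old_block_levels_of_cap`, (E100d)
`flow_nonneg_old_block_levels_of_cap_youngest`, (E99g) `flow_nonneg_two_cluster_levels_of_caps`,
(E100e) `old_block_load_le_span4`, (E97c) `young_pair_load_le`, (E94b) `load_le_of_sq` BY NAME.  NOT CLAIMED: spans `> 4`; consecutive double octaves closer
than ×100; anything printed — NOT B12 Thm 2, NOT BetaPertH, NOT continuum, NOT Clay.

WHAT IS PROVED ([folklore]; 0 `def`, 0 sorry).  §1 **`flow_nonneg_census_young_pair_double_octaves`**, **`flow_nonneg_young_age_double_octaves`**.  §2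
**`flow_nonneg_young_age_gap_double_octaves`**.  §3 **`flow_nonneg_census_young_pair_one_double_octave`**, **`flow_nonneg_young_age_one_double_octave`**.
-/
noncomputable section
open Finset

namespace Summit.QuantumFields.BalabanUV.Beta.EriceRemainderEnclosureHistoryAutonomyComparisonAgeCompositionOldBlockSeparatedAgesWide

open Literature.MathematicalPhysics.QuantumFieldTheory.Balaban1983to89
open Literature.MathematicalPhysics.QuantumFieldTheory.Balaban1983to89.T4BetaStationary
open Literature.MathematicalPhysics.QuantumFieldTheory.Balaban1983to89.T4BetaFlowWellPosed
open Summit.QuantumFields.BalabanUV.Beta.EriceRemainderEnclosureHistoryAutonomyComparisonAgeCompositionYoungPairMoment (load_le_of_sq)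
open Summit.QuantumFields.BalabanUV.Beta.EriceRemainderEnclosureHistoryAutonomyComparisonAgeCompositionOldBlockCapWide (old_block_load_le_span4)
open Summit.QuantumFields.BalabanUV.Beta.EriceRemainderEnclosureHistoryAutonomyComparisonAgeCompositionOldBlockSeparatedAges
  (flow_nonneg_old_block_levels_of_cap)
open Summit.QuantumFields.BalabanUV.Beta.EriceRemainderEnclosureHistoryAutonomyComparisonAgeCompositionTwoClusterLevels
  (flow_nonneg_two_cluster_levels_of_caps)
open Summit.QuantumFields.BalabanUV.Beta.EriceRemainderEnclosureHistoryAutonomyComparisonAgeCompositionOldBlockYoungestGap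
  (flow_nonneg_old_block_levels_of_cap_youngest)
open Summit.QuantumFields.BalabanUV.Beta.EriceRemainderEnclosureHistoryAutonomyComparisonAgeCompositionYoungPairCapSeparatedAges (young_pair_load_le)

variable {B : (ℕ → ℝ) → ℝ} {γ b gIR : ℝ} {L : ℕ → ℝ} {K : ℕ} {h g : ℕ → ℝ}

/-! ## §1 The census young pair, or any young age, below a ×100 chain of double octaves -/

/-- **THE CENSUS YOUNG PAIR `{1, k₂}`, `2 ≤ k₂ ≤ 29`, BELOW A ×100 CHAIN OF DOUBLE OCTAVES, ANY NUMBER OF LEVELS.**  Profile carried by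
`{1, k₂} ∪ ⋃_{1≤j<r} T j` with `T j ⊂ [a j, p j]` finite and arbitrary, `a j ≤ p j ≤ 4·a j`, `100k₂ ≤ a 1`, `100·p j ≤ a (j+1)`: `0 ≤ ε ≤ e` at every pin,
every horizon, every damping of the self-consistent class (`κ = 1∕5`, caps `0.8333` (E97c) and `11∕16` (E100e), `R₀ = 100`: `3.5 ≤ 3.5`). [folklore] -/
theorem flow_nonneg_census_young_pair_double_octaves
    (hmono : ∀ u v : ℕ → ℝ, SeqBox γ u → SeqBox γ v → (∀ j, u j ≤ v j) → B u ≤ B v)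
    (hL : ∀ k, 0 ≤ L k) (hb : 0 < b) (hlo : ∀ u, SeqBox γ u → b ≤ B u) (hdom : ∀ u, SeqBox γ u → ∑ k ∈ range K, L k * u k ≤ B u)
    (hh : SeqBox γ h) (hf : MemFlow B gIR h) (hg : ∀ t, 0 < g t ∧ g t ≤ 1)
    (hgF : ∀ t, 1 ≤ g t * (1 + ∑ k ∈ range K, L k * h (t + k) ^ 3 / 2))
    {k₂ : ℕ} (hk2 : 2 ≤ k₂) (hk29 : k₂ ≤ 29) (hk2K : k₂ < K)
    {r : ℕ} {T : ℕ → Finset ℕ} {a p : ℕ → ℕ} (hr : 1 ≤ r) (hap : ∀ j, 1 ≤ j → j < r → a j ≤ p j ∧ p j ≤ 4 * a j)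
    (hpK : ∀ j, 1 ≤ j → j < r → p j < K) (hT : ∀ j, 1 ≤ j → j < r → ∀ k ∈ T j, a j ≤ k ∧ k ≤ p j)
    (hsep0 : 1 < r → 100 * k₂ ≤ a 1) (hsep : ∀ j, 1 ≤ j → j + 1 < r → 100 * p j ≤ a (j + 1))
    (hLa : ∀ l, l < K → l ≠ 1 → l ≠ k₂ → (∀ j, 1 ≤ j → j < r → l ∉ T j) → L l = 0)
    {N : ℕ} {KL : ℕ → ℕ → ℕ → ℝ}
    (hKL : ∀ k n l, KL k n l = if 0 < k ∧ k < K ∧ l < k then L k * h (n + k) ^ 3 / 2 * ∏ t ∈ Ico (n + 1 + l) (n + k + 1), g t else 0)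
    {KA : ℕ → ℕ → ℕ → ℝ} {RA : ℕ → (ℕ → ℝ) → ℕ → ℝ}
    (hRA : ∀ i v m, RA i v m = ∑ l ∈ range K, KA i m l * v (m + 1 + l))
    (hKA : ∀ i m l, KA i m l = KL i m l + KA (i + 1) m l) (hKAtop : ∀ m l, KA K m l = 0)
    {e ε : ℕ → ℝ} (he0 : ∀ m, 0 ≤ e m) (hea : ∀ m, e (m + 1) ≤ e m)
    (hεt : ∀ m, N < m → ε m = 0) (hεrec : ∀ m, ε m = e m - RA 1 ε m) : ∀ m, 0 ≤ ε m ∧ ε m ≤ e m := by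
  refine flow_nonneg_old_block_levels_of_cap hmono hL hb hlo hdom hh hf hg hgF (by omega) (κ := 1 / 5) (s₀ := 8333 / 10000) (s := 11 / 16)
    (R₀ := 100) (Fm := 4) (by norm_num) (by norm_num) (by norm_num) (by norm_num) (by norm_num) (by norm_num)
    (fun S lo hi q h1 h2 h3 h4 => old_block_load_le_span4 hmono hL hb hlo hdom hh hf h1 h2 h3 h4 q) (S₀ := {1, k₂}) (hi₀ := k₂)
    (fun k hk => ?_) (fun k hk => ?_) (by omega) (fun q => ?_) hr hap hpK hT hsep0 hsep (fun l hl hl0 hno => ?_) hKL hRA hKA hKAtop he0 hea hεt hεrec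
  · simp only [mem_insert, mem_singleton] at hk; rcases hk with rfl | rfl <;> omega
  · simp only [mem_insert, mem_singleton] at hk; rcases hk with rfl | rfl <;> omega
  · rw [sum_pair (show (1 : ℕ) ≠ k₂ by omega), Nat.cast_one, one_mul]
    exact young_pair_load_le hmono hL hb hlo hdom hh hf hk2 hk29 hk2K q
  · refine hLa l hl (fun h1 => hl0 ?_) (fun h2 => hl0 ?_) hno
    · rw [h1]; exact mem_insert_self _ _
    · rw [h2]; exact mem_insert_of_mem (mem_singleton_self _)

/-- **ANY YOUNG AGE BELOW A ×100 CHAIN OF DOUBLE OCTAVES, ANY NUMBER OF LEVELS.**  Profile carried by `{a₀} ∪ ⋃_{1≤j<r} T j` with `a₀ ≥ 1` ARBITRARY,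
`T j ⊂ [a j, p j]` finite and arbitrary, `a j ≤ p j ≤ 4·a j`, `100a₀ ≤ a 1`, `100·p j ≤ a (j+1)`: `0 ≤ ε ≤ e` at every pin (`κ = 1∕5`, caps `0.7072` (E94b)
and `11∕16` (E100e), `R₀ = 100`). [folklore] -/
theorem flow_nonneg_young_age_double_octaves
    (hmono : ∀ u v : ℕ → ℝ, SeqBox γ u → SeqBox γ v → (∀ j, u j ≤ v j) → B u ≤ B v)
    (hL : ∀ k, 0 ≤ L k) (hb : 0 < b) (hlo : ∀ u, SeqBox γ u → b ≤ B u) (hdom : ∀ u, SeqBox γ u → ∑ k ∈ range K, L k * u k ≤ B u)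
    (hh : SeqBox γ h) (hf : MemFlow B gIR h) (hg : ∀ t, 0 < g t ∧ g t ≤ 1)
    (hgF : ∀ t, 1 ≤ g t * (1 + ∑ k ∈ range K, L k * h (t + k) ^ 3 / 2))
    {a₀ : ℕ} (ha0 : 1 ≤ a₀) (ha0K : a₀ < K)
    {r : ℕ} {T : ℕ → Finset ℕ} {a p : ℕ → ℕ} (hr : 1 ≤ r) (hap : ∀ j, 1 ≤ j → j < r → a j ≤ p j ∧ p j ≤ 4 * a j)
    (hpK : ∀ j, 1 ≤ j → j < r → p j < K) (hT : ∀ j, 1 ≤ j → j < r → ∀ k ∈ T j, a j ≤ k ∧ k ≤ p j)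
    (hsep0 : 1 < r → 100 * a₀ ≤ a 1) (hsep : ∀ j, 1 ≤ j → j + 1 < r → 100 * p j ≤ a (j + 1))
    (hLa : ∀ l, l < K → l ≠ a₀ → (∀ j, 1 ≤ j → j < r → l ∉ T j) → L l = 0)
    {N : ℕ} {KL : ℕ → ℕ → ℕ → ℝ}
    (hKL : ∀ k n l, KL k n l = if 0 < k ∧ k < K ∧ l < k then L k * h (n + k) ^ 3 / 2 * ∏ t ∈ Ico (n + 1 + l) (n + k + 1), g t else 0)
    {KA : ℕ → ℕ → ℕ → ℝ} {RA : ℕ → (ℕ → ℝ) → ℕ → ℝ}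
    (hRA : ∀ i v m, RA i v m = ∑ l ∈ range K, KA i m l * v (m + 1 + l))
    (hKA : ∀ i m l, KA i m l = KL i m l + KA (i + 1) m l) (hKAtop : ∀ m l, KA K m l = 0)
    {e ε : ℕ → ℝ} (he0 : ∀ m, 0 ≤ e m) (hea : ∀ m, e (m + 1) ≤ e m)
    (hεt : ∀ m, N < m → ε m = 0) (hεrec : ∀ m, ε m = e m - RA 1 ε m) : ∀ m, 0 ≤ ε m ∧ ε m ≤ e m := by
  refine flow_nonneg_old_block_levels_of_cap hmono hL hb hlo hdom hh hf hg hgF (by omega) (κ := 1 / 5) (s₀ := 7072 / 10000) (s := 11 / 16)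
    (R₀ := 100) (Fm := 4) (by norm_num) (by norm_num) (by norm_num) (by norm_num) (by norm_num) (by norm_num)
    (fun S lo hi q h1 h2 h3 h4 => old_block_load_le_span4 hmono hL hb hlo hdom hh hf h1 h2 h3 h4 q) (S₀ := {a₀}) (hi₀ := a₀)
    (fun k hk => ?_) (fun k hk => ?_) (by omega) (fun q => ?_) hr hap hpK hT hsep0 hsep (fun l hl hl0 hno => ?_) hKL hRA hKA hKAtop he0 hea hεt hεrec
  · rw [mem_singleton] at hk; subst hk; exact ⟨ha0, ha0K⟩
  · rw [mem_singleton] at hk; omega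
  · rw [sum_singleton]
    have ha0r : (1 : ℝ) ≤ a₀ := by exact_mod_cast ha0
    exact load_le_of_sq hmono hL hb hlo hdom hh hf ha0 ha0K (so := 7072 / 10000) (by norm_num) (by nlinarith) q
  · exact hLa l hl (fun h1 => hl0 (by rw [h1]; exact mem_singleton_self _)) hno

/-! ## §2 Any young age at ratio 49 below a ×100 chain of double octaves -/

/-- **ANY YOUNG AGE AT RATIO 49 BELOW A ×100 CHAIN OF DOUBLE OCTAVES, ANY NUMBER OF LEVELS.**  Profile carried by `{a₀} ∪ ⋃_{1≤j<r} T j` with `a₀ ≥ 1`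
ARBITRARY, `T j ⊂ [a j, p j]` finite and arbitrary, `a j ≤ p j ≤ 4·a j` (`56 ≤ a j` whenever `a j < p j`), `49·a₀ ≤ a 1`, `100·p j ≤ a (j+1)`:
`0 ≤ ε ≤ e` at every pin ((E100d) `flow_nonneg_old_block_levels_of_cap_youngest` with `κ = 1∕5`, `s₀ = 0.7072`, `s = 11∕16` ((E100e)
`old_block_load_le_span4`), `R₀ = 100`, `ρ₀ = 49`: `0.7072·(49·0.175 + 3.5) = 8.53944 ≤ 8.575`). [folklore] -/
theorem flow_nonneg_young_age_gap_double_octaves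
    (hmono : ∀ u v : ℕ → ℝ, SeqBox γ u → SeqBox γ v → (∀ j, u j ≤ v j) → B u ≤ B v)
    (hL : ∀ k, 0 ≤ L k) (hb : 0 < b) (hlo : ∀ u, SeqBox γ u → b ≤ B u) (hdom : ∀ u, SeqBox γ u → ∑ k ∈ range K, L k * u k ≤ B u)
    (hh : SeqBox γ h) (hf : MemFlow B gIR h) (hg : ∀ t, 0 < g t ∧ g t ≤ 1)
    (hgF : ∀ t, 1 ≤ g t * (1 + ∑ k ∈ range K, L k * h (t + k) ^ 3 / 2))
    {a₀ : ℕ} (ha0 : 1 ≤ a₀) (ha0K : a₀ < K)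
    {r : ℕ} {T : ℕ → Finset ℕ} {a p : ℕ → ℕ} (hr : 1 ≤ r) (hap : ∀ j, 1 ≤ j → j < r → a j ≤ p j ∧ p j ≤ 4 * a j)
    (h56 : ∀ j, 1 ≤ j → j < r → a j < p j → 56 ≤ a j) (hpK : ∀ j, 1 ≤ j → j < r → p j < K)
    (hT : ∀ j, 1 ≤ j → j < r → ∀ k ∈ T j, a j ≤ k ∧ k ≤ p j)
    (hsep0 : 1 < r → 49 * a₀ ≤ a 1) (hsep : ∀ j, 1 ≤ j → j + 1 < r → 100 * p j ≤ a (j + 1))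
    (hLa : ∀ l, l < K → l ≠ a₀ → (∀ j, 1 ≤ j → j < r → l ∉ T j) → L l = 0)
    {N : ℕ} {KL : ℕ → ℕ → ℕ → ℝ}
    (hKL : ∀ k n l, KL k n l = if 0 < k ∧ k < K ∧ l < k then L k * h (n + k) ^ 3 / 2 * ∏ t ∈ Ico (n + 1 + l) (n + k + 1), g t else 0)
    {KA : ℕ → ℕ → ℕ → ℝ} {RA : ℕ → (ℕ → ℝ) → ℕ → ℝ}
    (hRA : ∀ i v m, RA i v m = ∑ l ∈ range K, KA i m l * v (m + 1 + l))
    (hKA : ∀ i m l, KA i m l = KL i m l + KA (i + 1) m l) (hKAtop : ∀ m l, KA K m l = 0)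
    {e ε : ℕ → ℝ} (he0 : ∀ m, 0 ≤ e m) (hea : ∀ m, e (m + 1) ≤ e m)
    (hεt : ∀ m, N < m → ε m = 0) (hεrec : ∀ m, ε m = e m - RA 1 ε m) : ∀ m, 0 ≤ ε m ∧ ε m ≤ e m := by
  refine flow_nonneg_old_block_levels_of_cap_youngest hmono hL hb hlo hdom hh hf hg hgF (by omega) (κ := 1 / 5) (s₀ := 7072 / 10000)
    (s := 11 / 16) (R₀ := 100) (ρ₀ := 49) (Fm := 4) (by norm_num) (by norm_num) (by norm_num) (by norm_num) (by norm_num) (by norm_num) (by norm_num)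
    (by norm_num) (by norm_num) (fun S lo hi q h1 h2 h3 h4 => old_block_load_le_span4 hmono hL hb hlo hdom hh hf h1 h2 h3 h4 q)
    (S₀ := {a₀}) (hi₀ := a₀) (fun k hk => ?_) (fun k hk => ?_) ha0 (fun q => ?_) hr hap h56 hpK hT hsep0 hsep (fun l hl hl0 hno => ?_)
    hKL hRA hKA hKAtop he0 hea hεt hεrec
  · rw [mem_singleton] at hk; subst hk; exact ⟨ha0, ha0K⟩
  · rw [mem_singleton] at hk; omega
  · rw [sum_singleton]
    have ha0r : (1 : ℝ) ≤ a₀ := by exact_mod_cast ha0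
    exact load_le_of_sq hmono hL hb hlo hdom hh hf ha0 ha0K (so := 7072 / 10000) (by norm_num) (by nlinarith) q
  · exact hLa l hl (fun h1 => hl0 (by rw [h1]; exact mem_singleton_self _)) hno

/-! ## §3 Two levels: the young cluster below ONE double octave -/

/-- **THE CENSUS YOUNG PAIR `{1, k₂}`, `2 ≤ k₂ ≤ 29`, BELOW ONE DOUBLE OCTAVE AT GAP 45.**  Profile carried by `{1, k₂} ∪ T` with `T ⊂ [a, p]` finite and
arbitrary, `a ≤ p ≤ 4a`, `45k₂ ≤ a`, `p < K`: `0 ≤ ε ≤ e` at every pin ((E99g) `flow_nonneg_two_cluster_levels_of_caps`, caps `0.8333` ∕ `11∕16`,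
`κ = 1∕1000`, `ρ₀ = 45`: `13.98721 ≤ 14.0315625`; limit `ρ₀ ≥ 44`).  In particular the census four ages `{1, k₂, k₃, k₄}` with `45k₂ ≤ k₃ < k₄ ≤ 4k₃`.
[folklore] -/
theorem flow_nonneg_census_young_pair_one_double_octave
    (hmono : ∀ u v : ℕ → ℝ, SeqBox γ u → SeqBox γ v → (∀ j, u j ≤ v j) → B u ≤ B v)
    (hL : ∀ k, 0 ≤ L k) (hb : 0 < b) (hlo : ∀ u, SeqBox γ u → b ≤ B u) (hdom : ∀ u, SeqBox γ u → ∑ k ∈ range K, L k * u k ≤ B u)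
    (hh : SeqBox γ h) (hf : MemFlow B gIR h) (hg : ∀ t, 0 < g t ∧ g t ≤ 1)
    (hgF : ∀ t, 1 ≤ g t * (1 + ∑ k ∈ range K, L k * h (t + k) ^ 3 / 2))
    {k₂ a p : ℕ} (hk2 : 2 ≤ k₂) (hk29 : k₂ ≤ 29) (hgap : 45 * k₂ ≤ a) (hap : a ≤ p) (hp4 : p ≤ 4 * a) (hpK : p < K)
    {T : Finset ℕ} (hT : ∀ k ∈ T, a ≤ k ∧ k ≤ p)
    (hLa : ∀ l, l < K → l ≠ 1 → l ≠ k₂ → l ∉ T → L l = 0)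
    {N : ℕ} {KL : ℕ → ℕ → ℕ → ℝ}
    (hKL : ∀ k n l, KL k n l = if 0 < k ∧ k < K ∧ l < k then L k * h (n + k) ^ 3 / 2 * ∏ t ∈ Ico (n + 1 + l) (n + k + 1), g t else 0)
    {KA : ℕ → ℕ → ℕ → ℝ} {RA : ℕ → (ℕ → ℝ) → ℕ → ℝ}
    (hRA : ∀ i v m, RA i v m = ∑ l ∈ range K, KA i m l * v (m + 1 + l))
    (hKA : ∀ i m l, KA i m l = KL i m l + KA (i + 1) m l) (hKAtop : ∀ m l, KA K m l = 0)
    {e ε : ℕ → ℝ} (he0 : ∀ m, 0 ≤ e m) (hea : ∀ m, e (m + 1) ≤ e m)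
    (hεt : ∀ m, N < m → ε m = 0) (hεrec : ∀ m, ε m = e m - RA 1 ε m) : ∀ m, 0 ≤ ε m ∧ ε m ≤ e m := by
  refine flow_nonneg_two_cluster_levels_of_caps hmono hL hb hlo hdom hh hf hg hgF (by omega) (κ := 1 / 1000) (s₀ := 8333 / 10000)
    (s := 11 / 16) (ρ₀ := 45) (by norm_num) (by norm_num) (by norm_num) (by norm_num) (by norm_num)
    (S₀ := {1, k₂}) (S₁ := T) (hi₀ := k₂) (lo₁ := a) (hi₁ := p)
    (fun k hk => ?_) (fun k hk => ?_) (fun k hk => ?_) (fun k hk => (hT k hk).1) (fun k hk => (hT k hk).2) hap (by omega) (fun x hx y hy => ?_)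
    (fun l hl h0 h1 => ?_) (fun q => ?_) (fun q => ?_) hKL hRA hKA hKAtop he0 hea hεt hεrec
  · simp only [mem_insert, mem_singleton] at hk; rcases hk with rfl | rfl <;> omega
  · simp only [mem_insert, mem_singleton] at hk; rcases hk with rfl | rfl <;> omega
  · have := hT k hk; omega
  · simp only [mem_insert, mem_singleton] at hx
    have := hT y hy
    rcases hx with rfl | rfl <;> omega
  · refine hLa l hl (fun he => h0 ?_) (fun he => h0 ?_) h1
    · rw [he]; exact mem_insert_self _ _
    · rw [he]; exact mem_insert_of_mem (mem_singleton_self _)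
  · rw [sum_pair (show (1 : ℕ) ≠ k₂ by omega), Nat.cast_one, one_mul]
    exact young_pair_load_le hmono hL hb hlo hdom hh hf hk2 hk29 (by omega) q
  · exact old_block_load_le_span4 hmono hL hb hlo hdom hh hf (by omega) hp4 hpK hT q

/-- **ANY YOUNG AGE BELOW ONE DOUBLE OCTAVE AT GAP 22.**  Profile carried by `{a₀} ∪ T` with `a₀ ≥ 1` ARBITRARY, `T ⊂ [a, p]` finite and arbitrary,
`56 ≤ a ≤ p ≤ 4a`, `22a₀ ≤ a`, `p < K`: `0 ≤ ε ≤ e` at every pin ((E99g) with caps `0.7072` ∕ `11∕16`, `κ = 1∕1000`, `ρ₀ = 22`: `6.79876 ≤ 6.859875`;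
limit `ρ₀ ≥ 21.3`). [folklore] -/
theorem flow_nonneg_young_age_one_double_octave
    (hmono : ∀ u v : ℕ → ℝ, SeqBox γ u → SeqBox γ v → (∀ j, u j ≤ v j) → B u ≤ B v)
    (hL : ∀ k, 0 ≤ L k) (hb : 0 < b) (hlo : ∀ u, SeqBox γ u → b ≤ B u) (hdom : ∀ u, SeqBox γ u → ∑ k ∈ range K, L k * u k ≤ B u)
    (hh : SeqBox γ h) (hf : MemFlow B gIR h) (hg : ∀ t, 0 < g t ∧ g t ≤ 1)
    (hgF : ∀ t, 1 ≤ g t * (1 + ∑ k ∈ range K, L k * h (t + k) ^ 3 / 2))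
    {a₀ a p : ℕ} (ha0 : 1 ≤ a₀) (hgap : 22 * a₀ ≤ a) (h56 : 56 ≤ a) (hap : a ≤ p) (hp4 : p ≤ 4 * a) (hpK : p < K)
    {T : Finset ℕ} (hT : ∀ k ∈ T, a ≤ k ∧ k ≤ p)
    (hLa : ∀ l, l < K → l ≠ a₀ → l ∉ T → L l = 0)
    {N : ℕ} {KL : ℕ → ℕ → ℕ → ℝ}
    (hKL : ∀ k n l, KL k n l = if 0 < k ∧ k < K ∧ l < k then L k * h (n + k) ^ 3 / 2 * ∏ t ∈ Ico (n + 1 + l) (n + k + 1), g t else 0)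
    {KA : ℕ → ℕ → ℕ → ℝ} {RA : ℕ → (ℕ → ℝ) → ℕ → ℝ}
    (hRA : ∀ i v m, RA i v m = ∑ l ∈ range K, KA i m l * v (m + 1 + l))
    (hKA : ∀ i m l, KA i m l = KL i m l + KA (i + 1) m l) (hKAtop : ∀ m l, KA K m l = 0)
    {e ε : ℕ → ℝ} (he0 : ∀ m, 0 ≤ e m) (hea : ∀ m, e (m + 1) ≤ e m)
    (hεt : ∀ m, N < m → ε m = 0) (hεrec : ∀ m, ε m = e m - RA 1 ε m) : ∀ m, 0 ≤ ε m ∧ ε m ≤ e m := by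
  have ha0K : a₀ < K := by omega
  refine flow_nonneg_two_cluster_levels_of_caps hmono hL hb hlo hdom hh hf hg hgF (by omega) (κ := 1 / 1000) (s₀ := 7072 / 10000)
    (s := 11 / 16) (ρ₀ := 22) (by norm_num) (by norm_num) (by norm_num) (by norm_num) (by norm_num)
    (S₀ := {a₀}) (S₁ := T) (hi₀ := a₀) (lo₁ := a) (hi₁ := p)
    (fun k hk => ?_) (fun k hk => ?_) (fun k hk => ?_) (fun k hk => (hT k hk).1) (fun k hk => (hT k hk).2) hap (by omega) (fun x hx y hy => ?_)
    (fun l hl h0 h1 => ?_) (fun q => ?_) (fun q => ?_) hKL hRA hKA hKAtop he0 hea hεt hεrec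
  · rw [mem_singleton] at hk; subst hk; exact ⟨ha0, ha0K⟩
  · rw [mem_singleton] at hk; omega
  · have := hT k hk; omega
  · rw [mem_singleton] at hx
    have := hT y hy; omega
  · exact hLa l hl (fun he => h0 (by rw [he]; exact mem_singleton_self _)) h1
  · rw [sum_singleton]
    have ha0r : (1 : ℝ) ≤ a₀ := by exact_mod_cast ha0
    exact load_le_of_sq hmono hL hb hlo hdom hh hf ha0 ha0K (so := 7072 / 10000) (by norm_num) (by nlinarith) q
  · exact old_block_load_le_span4 hmono hL hb hlo hdom hh hf h56 hp4 hpK hT q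

end Summit.QuantumFields.BalabanUV.Beta.EriceRemainderEnclosureHistoryAutonomyComparisonAgeCompositionOldBlockSeparatedAgesWide
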